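import Literature.NumberTheory.DiophantineGeometry.FunctionFieldConstantExtensionRationalPlaces
import Literature.NumberTheory.DiophantineGeometry.FunctionFieldConstantExtensionGenusProofs
import Literature.NumberTheory.DiophantineGeometry.BelyiGaloisHurwitz
import HarnessLib

/-!
# Radical base change of a function field: `F' = F(g)`, `g^p = f`, is unramified above the places
# where `p ∣ v_P(f) ≥ 0` (Stichtenoth Prop. 3.7.3 (b), case `r_P = n`), and the `g`-line below it

Topic: `Literature/NumberTheory/DiophantineGeometry` (places `AlgFunctionField.PlaceOver` of function
fields `F/K`). Theorem-only file (no definition, no named fact). Let `F'/F` be a finite separable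
extension of algebraic function fields over `K`, generated by an element `g` with `g^p = f ∈ F`
(`F' = F(g)`, no irreducibility assumption on `T^p - f`), `p ≥ 1` with `p ≠ 0` in `K`.

* `PlaceOver.ord_algebraMap_uniformizer_eq_one_of_pow_eq_of_ord_eq_zero`,
  `PlaceOver.ord_algebraMap_uniformizer_eq_one_of_pow_eq` — **if `v_P(f) = p k ≥ 0` then every place
  `P'` of `F'` above `P` is unramified, `e(P'|P) = 1`** [Stichtenoth 2009, Prop. 3.7.3 (b) with
  Remark 3.7.5: `e(P'|P) = n / r_P`, `r_P = gcd(n, v_P(u))`, here `r_P = n`]. Proof as in the book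
  (via Kummer's theorem rather than Prop. 3.7.3's appeal to the theory of Kummer extensions):
  `y = g / π_P^k` generates `F'/F` and is a root of `T^p - u`, `u = f / π_P^{pk} ∈ 𝒪_Pˣ`, whose
  reduction `T^p - ū` is separable; so the minimal polynomial of `y` has separable reduction and
  Kummer's theorem [Stichtenoth 2009, Thm. 3.3.7, Cor. 3.3.8 (c)] gives `e = 1` at all places above
  `P` (the tree's `ord_algebraMap_uniformizer_eq_one_of_separable` assumes `K` finite; the count over
  an arbitrary `K` is redone here in private lemmas, as in
  `FunctionFieldConstantExtensionRationalPlaces`). This is the simplest instance of Abhyankar's lemma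
  [Stichtenoth 2009, Thm. 3.9.1] for the compositum `F · K(f^{1/p})`.
* `PlaceOver.ord_aeval_eq_one_of_pow_eq` — the consequence used for the specialisation of Belyi-type
  covers (Darmon–Granville, Bull. LMS 27 (1995), Prop. 3.2; Beckmann's theorem): if `f` is
  transcendental with `v_P(f) = p` at all its zeros and `F/K(f)` is unramified over every closed
  point `π₀ ∉ {X, X - 1}` of the `f`-line (`v_P(π₀(f)) ∈ {0, 1}`), then **`F'/K(g)` is unramified
  over every closed point `π` of the `g`-line with `π ∤ X^p - 1`**: `v_Q(π(g)) ∈ {0, 1}` for all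
  places `Q` of `F'` (over `g = 0` by the first result with `k = 1`; elsewhere by the first result
  with `k = 0` and the hypothesis at `ν = minpoly_K(f(P))`, using `π ∣ ν(X^p)`).
* Helpers on orders and residues of polynomial expressions: `PlaceOver.mem_of_ord_aeval_pos`
  (`v_Q(π(g)) > 0` for a non-constant `π` forces `g ∈ 𝒪_Q`),
  `PlaceOver.residue_aeval_eq`, `PlaceOver.ord_aeval_pos_iff` (`v_P(q(x)) > 0 ↔ q(x̄) = 0`),
  `PlaceOver.isUnit_of_ord_eq_zero`, `PlaceOver.residue_eq_zero_iff_ord_pos`.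

## References

* H. Stichtenoth, *Algebraic Function Fields and Codes*, 2nd ed., GTM 254, Springer 2009: Thm. 3.3.7,
  Cor. 3.3.8, Prop. 3.7.3 (b), Remark 3.7.5, Thm. 3.9.1 (held copy
  `book:stichtenothnd-algebraic-function-fields-codes`, PDF pp. 110–111, 121–123). [Stichtenoth2009]
* H. Darmon, A. Granville, *On the equations `z^m = F(x, y)` and `A x^p + B y^q = C z^r`*,
  Bull. London Math. Soc. 27 (1995) 513–543, §3, Prop. 3.2. [DarmonGranville1995]
-/

noncomputable section

open scoped Classical Polynomial IntermediateField
open Polynomial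

namespace Literature.NumberTheory.DiophantineGeometry.AlgFunctionField

universe u v

namespace PlaceOver

variable {K : Type u} {F : Type v} {F' : Type v} [Field K] [Field F] [Algebra K F]
variable [Field F'] [Algebra F F'] [Algebra K F'] [IsScalarTower K F F']

variable [IsAlgFunctionField K F'] in
/-- **`deg γ · deg P ≤ deg P'`** when `γ ∈ F_P[T]` is irreducible and has the root `z̄ ∈ F'_{P'}`, over
an arbitrary constant field (`F_P[T]/(γ) ↪ F'_{P'}` is `F_P`-linear, and dimensions over `K`
multiply in the tower `K ⊆ F_P ⊆ F_P[T]/(γ)`; Stichtenoth Thm. 3.3.7: `f(P_i|P) ≥ deg φ_i`). The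
tree's `natDegree_mul_degree_le_degree` is the cardinality count for finite `K`.
[cite: Stichtenoth2009, Thm. 3.3.7] -/
private theorem natDegree_mul_degree_le_degree_of_isAlgFunctionField {P : PlaceOver K F} {P' : PlaceOver K F'}
    (hBP : ∀ x : F, algebraMap F F' x ∈ P'.toValuationSubring ↔ x ∈ P.toValuationSubring)
    {γ : (P.residueField)[X]} (hγ : Irreducible γ) (z : P'.toValuationSubring)
    (hz : aeval (IsLocalRing.residue P'.toValuationSubring z)
      (γ.map (IsLocalRing.ResidueField.map (resHom P P' hBP))) = 0) :
    γ.natDegree * P.degree ≤ P'.degree := by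
  haveI : Fact (Irreducible γ) := ⟨hγ⟩
  set ι := IsLocalRing.ResidueField.map (resHom P P' hBP) with hι
  letI : Algebra P.residueField P'.residueField := ι.toAlgebra
  haveI : IsScalarTower K P.residueField P'.residueField :=
    IsScalarTower.of_algebraMap_eq' (residueField_map_comp_algebraMap hBP).symm
  have hz' : aeval (IsLocalRing.residue P'.toValuationSubring z) γ = 0 := by
    rw [aeval_def, IsScalarTower.algebraMap_eq P.residueField P'.residueField, ← hz, aeval_def,
      eval₂_map]
    rfl
  -- `F_P[T]/(γ) →ₐ[F_P] F'_{P'}`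
  have hz'' : γ.eval₂ (Algebra.ofId P.residueField P'.residueField)
      (IsLocalRing.residue P'.toValuationSubring z) = 0 := hz'
  set θ : AdjoinRoot γ →ₐ[P.residueField] P'.residueField :=
    AdjoinRoot.liftAlgHom γ (Algebra.ofId P.residueField P'.residueField)
      (IsLocalRing.residue P'.toValuationSubring z) hz'' with hθ
  haveI : FiniteDimensional K P'.residueField := finiteDimensional_residueField_holds P'
  have hinj : Function.Injective (θ.restrictScalars K).toLinearMap := θ.injective
  have h1 := LinearMap.finrank_le_finrank_of_injective hinj
  have h2 : Module.finrank K (AdjoinRoot γ) =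
      Module.finrank K P.residueField * γ.natDegree := by
    rw [← Module.finrank_mul_finrank K P.residueField (AdjoinRoot γ),
      (AdjoinRoot.powerBasis hγ.ne_zero).finrank, AdjoinRoot.powerBasis_dim]
  rw [h2] at h1
  unfold degree
  rw [mul_comm]
  exact h1




section OrdResidue

omit [IsScalarTower K F F'] in
/-- A non-zero element of `𝒪_P` of order `0` is a unit of `𝒪_P`. [folklore] -/
theorem isUnit_of_ord_eq_zero (P : PlaceOver K F) {x : F} (hx : x ∈ P.toValuationSubring)
    (hx0 : x ≠ 0) (h : P.ord x = 0) : IsUnit (⟨x, hx⟩ : P.toValuationSubring) := by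
  rw [P.toValuationSubring.valuation_eq_one_iff]
  change P.valuation x = 1
  rw [P.valuation_eq_zpow_ord hx0, h, zpow_zero]

omit [IsScalarTower K F F'] in
/-- For `x ∈ 𝒪_P`, `x ≠ 0`: `x̄ = 0` in `F_P` iff `ord_P x > 0`. [folklore] -/
theorem residue_eq_zero_iff_ord_pos (P : PlaceOver K F) {x : F} (hx : x ∈ P.toValuationSubring)
    (hx0 : x ≠ 0) :
    IsLocalRing.residue P.toValuationSubring ⟨x, hx⟩ = 0 ↔ 0 < P.ord x := by
  rw [IsLocalRing.residue_eq_zero_iff, P.toValuationSubring.valuation_lt_one_iff,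
    ← P.valuation_lt_one_iff_ord_pos hx0]


omit [IsScalarTower K F F'] in
/-- **Orders of polynomials at a pole.** If `ord_Q g < 0` and `π ≠ 0`, then
`ord_Q π(g) = deg π · ord_Q g` (the leading term dominates); a private copy of the tree's
`PlaceOver.ord_aeval_of_ord_neg` of `BelyiTheorem` (not imported: that module carries the Faltings
height theory). [folklore] -/
private theorem ord_aeval_eq_natDegree_mul_of_ord_neg (Q : PlaceOver K F) {g : F} (hg : Q.ord g < 0) {π : K[X]}
    (hπ : π ≠ 0) : aeval g π ≠ 0 ∧ Q.ord (aeval g π) = π.natDegree * Q.ord g := by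
  have hg0 : g ≠ 0 := by rintro rfl; rw [PlaceOver.ord_zero] at hg; exact lt_irrefl _ hg
  haveI : Invertible g := invertibleOfNonzero hg0
  have hinv : 0 < Q.ord g⁻¹ := by rw [Q.ord_inv hg0]; omega
  -- `π(g) = π_rev(1/g) · g^{deg π}` with `π_rev(0) = lc(π) ≠ 0`
  have hrev : aeval g⁻¹ π.reverse * g ^ π.natDegree = aeval g π := by
    rw [aeval_def, aeval_def, ← invOf_eq_inv]
    exact eval₂_reverse_mul_pow _ g π
  have hrev0 : π.reverse.eval 0 ≠ 0 := by
    rw [← coeff_zero_eq_eval_zero, coeff_zero_reverse]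
    exact leadingCoeff_ne_zero.2 hπ
  obtain ⟨hne, hord⟩ := Q.ord_aeval_eq_zero_of_eval_ne_zero hinv hrev0
  rw [← hrev]
  refine ⟨mul_ne_zero hne (pow_ne_zero _ hg0), ?_⟩
  rw [Q.ord_mul_eq hne (pow_ne_zero _ hg0), hord, Q.ord_pow hg0, zero_add]

omit [IsScalarTower K F F'] in
/-- `g ∈ 𝒪_Q` as soon as some non-constant polynomial in `g` has positive order at `Q`.
[folklore] -/
theorem mem_of_ord_aeval_pos (Q : PlaceOver K F) {g : F} {π : K[X]} (hπ : 0 < π.natDegree)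
    (h : 0 < Q.ord (aeval g π)) : g ∈ Q.toValuationSubring := by
  by_cases hg0 : g = 0
  · rw [hg0]; exact zero_mem _
  by_contra hmem
  have hneg : Q.ord g < 0 := by
    rwa [Q.mem_toValuationSubring_iff_ord_nonneg hg0, not_le] at hmem
  obtain ⟨-, hord⟩ := Q.ord_aeval_eq_natDegree_mul_of_ord_neg hneg (ne_zero_of_natDegree_gt hπ)
  rw [hord] at h
  have : (π.natDegree : ℤ) * Q.ord g < 0 := mul_neg_of_pos_of_neg (by exact_mod_cast hπ) hneg
  omega

omit [IsScalarTower K F F'] in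
/-- The residue of `q(x)` is `q(x̄)` for `x ∈ 𝒪_P` and `q ∈ K[X]`. [folklore] -/
theorem residue_aeval_eq (P : PlaceOver K F) {x : F} (hx : x ∈ P.toValuationSubring) (q : K[X]) :
    IsLocalRing.residue P.toValuationSubring ⟨aeval x q, P.aeval_mem hx q⟩ =
      aeval (IsLocalRing.residue P.toValuationSubring ⟨x, hx⟩) q := by
  have h1 : (⟨aeval x q, P.aeval_mem hx q⟩ : P.toValuationSubring) =
      aeval (⟨x, hx⟩ : P.toValuationSubring) q := by
    apply Subtype.ext
    change aeval x q = algebraMap P.toValuationSubring F (aeval (⟨x, hx⟩ : P.toValuationSubring) q)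
    rw [← aeval_algebraMap_apply]; rfl
  rw [h1, aeval_def, aeval_def, hom_eval₂]
  rfl

omit [IsScalarTower K F F'] in
/-- For `x ∈ 𝒪_P` and `q ∈ K[X]` with `q(x) ≠ 0`: `ord_P q(x) > 0 ↔ q(x̄) = 0`. [folklore] -/
theorem ord_aeval_pos_iff (P : PlaceOver K F) {x : F} (hx : x ∈ P.toValuationSubring) {q : K[X]}
    (hq : aeval x q ≠ 0) :
    0 < P.ord (aeval x q) ↔ aeval (IsLocalRing.residue P.toValuationSubring ⟨x, hx⟩) q = 0 := by
  rw [← P.residue_aeval_eq hx q, P.residue_eq_zero_iff_ord_pos (P.aeval_mem hx q) hq]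

end OrdResidue

section KummerExistence

variable [IsAlgFunctionField K F] [FiniteDimensional F F'] [Algebra.IsSeparable F F']


open IsDedekindDomain in
omit [IsAlgFunctionField K F] in
/-- **Kummer's theorem, existence half** (Stichtenoth Thm. 3.3.7) over an ARBITRARY constant field
`K` (the tree's `exists_placeOver_aeval_residue_eq_zero` assumes `K` finite, only to see the
constants inside the valuation ring `B_𝔔`; here `K ⊆ 𝒪_P ⊆ B ⊆ B_𝔔` directly): for a (monic)
irreducible factor `γ` of `φ̄ = φ mod P`, where `φ ∈ 𝒪_P[T]` is monic with `φ = minpoly_F(y)`,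
`y ∈ F'`, there is a place `P'` of `F'/K` above `P` with `y ∈ 𝒪_{P'}` and `γ(ȳ) = 0` in `F'_{P'}`.
The proof is the tree's (the book's): `𝒪_P[T] → F_P[T]/(γ)` kills `φ`, factors through
`𝒪_P[y] ⊆ B` (the integral closure of `𝒪_P` in `F'`), its kernel lies under a maximal ideal `𝔔`
of `B`, and `B_𝔔` is the valuation ring of the place. [cite: Stichtenoth2009, Thm. 3.3.7] -/
private theorem exists_placeOver_aeval_residue_eq_zero' (P : PlaceOver K F) {y : F'}
    {φ : (P.toValuationSubring)[X]} (hφm : φ.Monic)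
    (hφ : minpoly F y = φ.map (algebraMap P.toValuationSubring F))
    {γ : (P.residueField)[X]} (hγ : Irreducible γ)
    (hdvd : γ ∣ φ.map (IsLocalRing.residue P.toValuationSubring)) :
    ∃ (P' : PlaceOver K F')
      (hBP : ∀ x : F, algebraMap F F' x ∈ P'.toValuationSubring ↔ x ∈ P.toValuationSubring)
      (hy : y ∈ P'.toValuationSubring),
      aeval (IsLocalRing.residue P'.toValuationSubring ⟨y, hy⟩)
        (γ.map (IsLocalRing.ResidueField.map (resHom P P' hBP))) = 0 := by
  haveI : Fact (Irreducible γ) := ⟨hγ⟩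
  obtain ⟨hyint, hmin⟩ := P.isIntegral_and_minpoly_eq_of_minpoly_eq_map hφm hφ
  set yB : integralClosure P.toValuationSubring F' :=
    ⟨y, (mem_integralClosure_iff P.toValuationSubring F').2 hyint⟩ with hyB
  have hyBint : IsIntegral P.toValuationSubring yB := integralClosure.isIntegral yB
  have hminB : minpoly P.toValuationSubring yB = φ := by
    have h := minpoly.isIntegrallyClosed_eq_field_fractions F F' hyBint
    rw [show algebraMap _ F' yB = y from rfl, hφ] at h
    exact (Polynomial.map_injective _ (FaithfulSMul.algebraMap_injective _ _) h).symm
  -- `𝒪_P[T] → B`, `T ↦ y`, with kernel `(φ)`; `B` is integral over `𝒪_P[T]` through it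
  set ev : (P.toValuationSubring)[X] →ₐ[P.toValuationSubring] integralClosure P.toValuationSubring F' :=
    aeval yB with hev
  letI : Algebra (P.toValuationSubring)[X] (integralClosure P.toValuationSubring F') :=
    ev.toRingHom.toAlgebra
  have halg : ∀ p : (P.toValuationSubring)[X],
      algebraMap (P.toValuationSubring)[X] (integralClosure P.toValuationSubring F') p = ev p :=
    fun _ => rfl
  haveI : IsScalarTower P.toValuationSubring (P.toValuationSubring)[X]
      (integralClosure P.toValuationSubring F') :=
    IsScalarTower.of_algebraMap_eq fun c => by rw [halg, Polynomial.algebraMap_apply, hev, aeval_C]; rfl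
  haveI : Algebra.IsIntegral (P.toValuationSubring)[X] (integralClosure P.toValuationSubring F') :=
    Algebra.IsIntegral.tower_top P.toValuationSubring
  have hker : RingHom.ker (algebraMap (P.toValuationSubring)[X]
      (integralClosure P.toValuationSubring F')) = Ideal.span {φ} := by
    rw [RingHom.algebraMap_toAlgebra, hev, ← hminB]
    exact minpoly.ker_eval hyBint
  -- `ψ₀ : 𝒪_P[T] → F_P[T]/(γ)` is onto; its kernel is a maximal ideal containing `ker ev`
  set ψ₀ : (P.toValuationSubring)[X] →+* AdjoinRoot γ :=
    eval₂RingHom ((AdjoinRoot.of γ).comp (IsLocalRing.residue P.toValuationSubring)) (AdjoinRoot.root γ)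
    with hψ₀def
  have hψ₀ : ∀ p : (P.toValuationSubring)[X],
      ψ₀ p = AdjoinRoot.mk γ (p.map (IsLocalRing.residue P.toValuationSubring)) := fun p =>
    P.eval₂_residue_root_eq p
  have hψsurj : Function.Surjective ψ₀ := by
    intro l
    induction l using AdjoinRoot.induction_on with
    | ih p =>
      obtain ⟨q, rfl⟩ := Polynomial.map_surjective _ IsLocalRing.residue_surjective p
      exact ⟨q, hψ₀ q⟩
  set M : Ideal (P.toValuationSubring)[X] := RingHom.ker ψ₀ with hM
  haveI hMmax : M.IsMaximal := RingHom.ker_isMaximal_of_surjective ψ₀ hψsurj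
  have hle : RingHom.ker (algebraMap (P.toValuationSubring)[X]
      (integralClosure P.toValuationSubring F')) ≤ M := by
    rw [hker, Ideal.span_singleton_le_iff_mem, hM, RingHom.mem_ker]
    exact P.eval₂_residue_root_eq_zero_of_dvd φ hdvd
  have hMO : M.comap (algebraMap P.toValuationSubring (P.toValuationSubring)[X]) =
      IsLocalRing.maximalIdeal P.toValuationSubring := by
    ext c
    rw [Ideal.mem_comap, hM, RingHom.mem_ker, Polynomial.algebraMap_apply, hψ₀, Polynomial.map_C,
      AdjoinRoot.mk_C, map_eq_zero_iff _ (AdjoinRoot.of γ).injective, IsLocalRing.residue_eq_zero_iff]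
    rfl
  -- lying over: a maximal ideal `𝔔` of `B` above `M`, hence above `P`
  obtain ⟨Q, hQmax, hQM⟩ := Ideal.exists_ideal_over_maximal_of_isIntegral M hle
  have hQO : Q.comap (algebraMap P.toValuationSubring (integralClosure P.toValuationSubring F')) =
      IsLocalRing.maximalIdeal P.toValuationSubring := by
    rw [IsScalarTower.algebraMap_eq P.toValuationSubring (P.toValuationSubring)[X]
      (integralClosure P.toValuationSubring F'), ← Ideal.comap_comap, hQM, hMO]
  haveI hQlies : Q.LiesOver (IsLocalRing.maximalIdeal P.toValuationSubring) := ⟨hQO.symm⟩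
  have hQbot : Q ≠ ⊥ :=
    Ideal.ne_bot_of_liesOver_of_ne_bot (IsDiscreteValuationRing.not_a_field P.toValuationSubring) _
  set v : HeightOneSpectrum (integralClosure P.toValuationSubring F') := ⟨Q, hQmax.isPrime, hQbot⟩
    with hv
  haveI : v.asIdeal.LiesOver (IsLocalRing.maximalIdeal P.toValuationSubring) := hQlies
  -- the place of `𝔔`: valuation ring `B_𝔔`, which contains `K ⊆ 𝒪_P ⊆ B`
  have hKmem : ∀ c : K, algebraMap K F' c ∈ (v.valuation F').valuationSubring := fun c => by
    have : algebraMap K F' c =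
        algebraMap (integralClosure P.toValuationSubring F') F'
          (algebraMap P.toValuationSubring _ ⟨algebraMap K F c, P.algebraMap_mem c⟩) := by
      rw [IsScalarTower.algebraMap_apply K F F' c]; rfl
    rw [Valuation.mem_valuationSubring_iff, this]
    exact HeightOneSpectrum.valuation_le_one v _
  let Pv : PlaceOver K F' :=
    { toValuationSubring := (v.valuation F').valuationSubring
      ne_top := P.valuationSubring_integralClosure_ne_top v
      isDVR := P.isDiscreteValuationRing_valuationSubring_integralClosure v
      algebraMap_mem := hKmem }
  have hPv : ∀ z : F', z ∈ Pv.toValuationSubring ↔ v.valuation F' z ≤ 1 := fun z => Iff.rfl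
  -- `Pv` lies above `P`
  have hBP : ∀ x : F, algebraMap F F' x ∈ Pv.toValuationSubring ↔ x ∈ P.toValuationSubring := by
    intro x
    constructor
    · intro hx
      by_contra hxP
      have hx0 : x ≠ 0 := by rintro rfl; exact hxP (zero_mem _)
      have hinv : x⁻¹ ∈ P.toValuationSubring :=
        (P.toValuationSubring.mem_or_inv_mem x).resolve_left hxP
      have h1 : 1 < P.valuation x :=
        not_le.1 (mt (P.toValuationSubring.valuation_le_one_iff x).1 hxP)
      have h2 : P.valuation x⁻¹ < 1 := (Valuation.one_lt_val_iff _ hx0).1 h1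
      have hmax : (⟨x⁻¹, hinv⟩ : P.toValuationSubring) ∈
          IsLocalRing.maximalIdeal P.toValuationSubring :=
        (ValuationSubring.valuation_lt_one_iff _ _).2 h2
      have hmem : algebraMap P.toValuationSubring (integralClosure P.toValuationSubring F')
          ⟨x⁻¹, hinv⟩ ∈ v.asIdeal := by
        rw [← Ideal.mem_comap]
        change _ ∈ v.asIdeal.under _
        rw [← Ideal.LiesOver.over (P := v.asIdeal)
          (p := IsLocalRing.maximalIdeal P.toValuationSubring)]
        exact hmax
      have h3 := (HeightOneSpectrum.valuation_lt_one_iff_mem (K := F') v _).2 hmem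
      have h4 : ((algebraMap P.toValuationSubring (integralClosure P.toValuationSubring F')
          ⟨x⁻¹, hinv⟩ : integralClosure P.toValuationSubring F') : F') = (algebraMap F F' x)⁻¹ := by
        rw [← map_inv₀]; rfl
      have h3' : HeightOneSpectrum.valuation F' v ((algebraMap F F' x)⁻¹) < 1 := by
        rw [← h4]; exact h3
      rw [← Valuation.one_lt_val_iff _ ((_root_.map_ne_zero _).2 hx0)] at h3'
      exact (not_le.2 h3') ((hPv _).1 hx)
    · intro hx
      have : algebraMap F F' x =
          algebraMap (integralClosure P.toValuationSubring F') F'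
            (algebraMap P.toValuationSubring _ ⟨x, hx⟩) := rfl
      rw [hPv, this]
      exact HeightOneSpectrum.valuation_le_one v _
  have hy : y ∈ Pv.toValuationSubring := coe_mem_of_mem_integralClosure _ hBP yB
  refine ⟨Pv, hBP, hy, ?_⟩
  -- a lift `G` of `γ` has `G(y) ∈ 𝔔`, i.e. `Ḡ(ȳ) = γ(ȳ) = 0`
  obtain ⟨G, hG⟩ :=
    Polynomial.map_surjective (IsLocalRing.residue P.toValuationSubring) IsLocalRing.residue_surjective γ
  have hGQ : ev G ∈ Q := by
    have : G ∈ Q.comap (algebraMap (P.toValuationSubring)[X]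
        (integralClosure P.toValuationSubring F')) := by
      rw [hQM, hM, RingHom.mem_ker, hψ₀, hG, AdjoinRoot.mk_self]
    exact this
  have hval : HeightOneSpectrum.valuation F' v (ev G : F') < 1 :=
    (HeightOneSpectrum.valuation_lt_one_iff_mem v _).2 hGQ
  have hevalmem : ((G.map (resHom P _ hBP)).eval ⟨y, hy⟩ : Pv.toValuationSubring) ∈
      IsLocalRing.maximalIdeal Pv.toValuationSubring := by
    rw [ValuationSubring.valuation_lt_one_iff]
    change ((v.valuation F').valuationSubring).valuation _ < 1
    rw [← (Valuation.isEquiv_valuation_valuationSubring (v.valuation F')).lt_one_iff_lt_one,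
      coe_eval_map_resHom]
    convert hval using 2
    rw [hev, ← Subalgebra.aeval_coe, aeval_def]
  rw [← hG, aeval_residue_map_map, IsLocalRing.residue_eq_zero_iff]
  exact hevalmem

end KummerExistence

section KummerCount

variable [IsAlgFunctionField K F] [FiniteDimensional F F'] [Algebra.IsSeparable F F']
  [IsAlgFunctionField K F']

/-- **Kummer's theorem** (Stichtenoth Thm. 3.3.7) over an ARBITRARY constant field `K` (the tree's
`exists_placesOver_of_prod_eq` assumes `K` finite, through the cardinality count in
`natDegree_mul_degree_le_degree`; the proof below is the same count with dimensions over `K`).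
Let `φ ∈ 𝒪_P[T]` be monic with `φ = minpoly_F(y)`, `[F' : F] = deg φ`, and `φ̄ = ∏_{γ ∈ S} γ`
with `S` a finite set of monic irreducible polynomials over `F_P`. Then there are places `P_γ`
(`γ ∈ S`) above `P`, pairwise distinct, exhausting the places above `P`, with `y ∈ 𝒪_{P_γ}`,
`γ(ȳ) = 0` in `F'_{P_γ}`, `e(P_γ|P) = 1` and `deg P_γ = deg γ · deg P`.
[cite: Stichtenoth2009, Thm. 3.3.7] -/
private theorem exists_placesOver_of_prod_eq_of_isAlgFunctionField (P : PlaceOver K F) {y : F'}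
    {φ : (P.toValuationSubring)[X]} (hφm : φ.Monic)
    (hφ : minpoly F y = φ.map (algebraMap P.toValuationSubring F))
    (hdeg : Module.finrank F F' = φ.natDegree)
    (S : Finset (P.residueField)[X]) (hirr : ∀ γ ∈ S, Irreducible γ) (hmon : ∀ γ ∈ S, γ.Monic)
    (hprod : ∏ γ ∈ S, γ = φ.map (IsLocalRing.residue P.toValuationSubring)) :
    ∃ Φ : (P.residueField)[X] → PlaceOver K F',
      Set.InjOn Φ S ∧
      (∀ P' : PlaceOver K F', P'.restrict (K := K) (F := F) = P → ∃ γ ∈ S, Φ γ = P') ∧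
      ∀ γ ∈ S, (Φ γ).restrict (K := K) (F := F) = P ∧
        (∀ (hBP : ∀ x : F, algebraMap F F' x ∈ (Φ γ).toValuationSubring ↔ x ∈ P.toValuationSubring)
          (hy : y ∈ (Φ γ).toValuationSubring),
          aeval (IsLocalRing.residue (Φ γ).toValuationSubring ⟨y, hy⟩)
            (γ.map (IsLocalRing.ResidueField.map (resHom P (Φ γ) hBP))) = 0) ∧
        (Φ γ).ord (algebraMap F F' (P.uniformizer : F)) = 1 ∧
        (Φ γ).degree = γ.natDegree * P.degree := by
  -- each `γ ∈ S` divides `φ̄`; choose a place `Φ γ` above `P` with `γ(ȳ) = 0`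
  have hdvd : ∀ γ ∈ S, γ ∣ φ.map (IsLocalRing.residue P.toValuationSubring) := fun γ hγ => by
    rw [← hprod]; exact Finset.dvd_prod_of_mem _ hγ
  obtain ⟨P₀, hP₀⟩ := P.exists_restrict_eq' (F' := F')
  have hex := fun γ (hγ : γ ∈ S) =>
    P.exists_placeOver_aeval_residue_eq_zero' hφm hφ (hirr γ hγ) (hdvd γ hγ)
  set Φ : (P.residueField)[X] → PlaceOver K F' := fun γ =>
    if hγ : γ ∈ S then (hex γ hγ).choose else P₀ with hΦ
  have hΦspec : ∀ γ (hγ : γ ∈ S), ∃ (hBP : ∀ x : F, algebraMap F F' x ∈ (Φ γ).toValuationSubring ↔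
      x ∈ P.toValuationSubring) (hy : y ∈ (Φ γ).toValuationSubring),
      aeval (IsLocalRing.residue (Φ γ).toValuationSubring ⟨y, hy⟩)
        (γ.map (IsLocalRing.ResidueField.map (resHom P (Φ γ) hBP))) = 0 := by
    intro γ hγ
    have hΦγ : Φ γ = (hex γ hγ).choose := dif_pos hγ
    rw [hΦγ]
    exact (hex γ hγ).choose_spec
  have hres : ∀ γ ∈ S, (Φ γ).restrict (K := K) (F := F) = P := fun γ hγ => by
    obtain ⟨hBP, -, -⟩ := hΦspec γ hγ
    exact (restrict_eq_iff _ _).2 hBP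
  have hroot : ∀ γ ∈ S, ∀ (hBP : ∀ x : F, algebraMap F F' x ∈ (Φ γ).toValuationSubring ↔
      x ∈ P.toValuationSubring) (hy : y ∈ (Φ γ).toValuationSubring),
      aeval (IsLocalRing.residue (Φ γ).toValuationSubring ⟨y, hy⟩)
        (γ.map (IsLocalRing.ResidueField.map (resHom P (Φ γ) hBP))) = 0 := by
    intro γ hγ hBP hy
    obtain ⟨hBP', hy', h⟩ := hΦspec γ hγ
    exact h
  have hdegle : ∀ γ ∈ S, γ.natDegree * P.degree ≤ (Φ γ).degree := fun γ hγ => by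
    obtain ⟨hBP, hy, h⟩ := hΦspec γ hγ
    exact natDegree_mul_degree_le_degree_of_isAlgFunctionField hBP (hirr γ hγ) ⟨y, hy⟩ h
  -- distinct factors give distinct places
  have hinj : Set.InjOn Φ S := by
    intro γ₁ h₁ γ₂ h₂ heq
    by_contra hne
    have hcop : IsCoprime γ₁ γ₂ := by
      rw [(hirr γ₁ h₁).coprime_iff_not_dvd]
      intro hd
      exact hne (eq_of_monic_of_associated (hmon γ₁ h₁) (hmon γ₂ h₂)
        ((hirr γ₁ h₁).associated_of_dvd (hirr γ₂ h₂) hd))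
    obtain ⟨hBP, hy, hr₁⟩ := hΦspec γ₁ h₁
    have hr₂ := hroot γ₂ h₂
    rw [← heq] at hr₂
    exact not_isCoprime_of_aeval_eq_zero hBP _ hr₁ (hr₂ hBP hy) hcop
  -- the count
  set T := (P.finite_setOf_restrict_eq (F' := F')).toFinset with hT
  have hTmem := P.mem_toFinset_restrict_eq_iff (F' := F')
  have hsumT := P.sum_ramification_mul_degree_eq (F' := F') T hTmem
  have himage : S.image Φ ⊆ T := by
    intro P' hP'
    obtain ⟨γ, hγ, rfl⟩ := Finset.mem_image.1 hP'
    exact (hTmem _).2 (hres γ hγ)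
  have he1 : ∀ γ ∈ S, 1 ≤ (Φ γ).ord (algebraMap F F' (P.uniformizer : F)) := fun γ hγ => by
    have := (Φ γ).one_le_ord_algebraMap_uniformizer (K := K) (F := F)
    rwa [hres γ hγ] at this
  have hnonnegT : ∀ Q ∈ T, 0 ≤ Q.ord (algebraMap F F' (P.uniformizer : F)) * (Q.degree : ℤ) := by
    intro Q hQ
    have := Q.one_le_ord_algebraMap_uniformizer (K := K) (F := F)
    rw [(hTmem Q).1 hQ] at this
    positivity
  have hnatdeg : ∑ γ ∈ S, γ.natDegree = φ.natDegree := by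
    rw [← natDegree_prod _ _ (fun γ hγ => (hirr γ hγ).ne_zero), hprod, hφm.natDegree_map]
  have hAB : ∑ Q ∈ S.image Φ, Q.ord (algebraMap F F' (P.uniformizer : F)) * (Q.degree : ℤ) ≤
      ∑ Q ∈ T, Q.ord (algebraMap F F' (P.uniformizer : F)) * (Q.degree : ℤ) :=
    Finset.sum_le_sum_of_subset_of_nonneg himage fun Q hQ _ => hnonnegT Q hQ
  rw [Finset.sum_image hinj] at hAB
  have hBC : ∀ γ ∈ S, ((Φ γ).degree : ℤ) ≤
      (Φ γ).ord (algebraMap F F' (P.uniformizer : F)) * ((Φ γ).degree : ℤ) := fun γ hγ => by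
    have := he1 γ hγ; have : (0 : ℤ) ≤ (Φ γ).degree := by positivity
    nlinarith
  have hCD : ∀ γ ∈ S, (γ.natDegree : ℤ) * P.degree ≤ ((Φ γ).degree : ℤ) := fun γ hγ => by
    exact_mod_cast hdegle γ hγ
  have hDA : ∑ γ ∈ S, (γ.natDegree : ℤ) * P.degree = Module.finrank F F' * (P.degree : ℤ) := by
    rw [← Finset.sum_mul, hdeg, ← hnatdeg]; push_cast; rfl
  have hsum₁ := Finset.sum_le_sum hCD
  have hsum₂ := Finset.sum_le_sum hBC
  -- equality everywhere
  have hCD' : ∑ γ ∈ S, (((Φ γ).degree : ℤ) - (γ.natDegree : ℤ) * P.degree) = 0 := by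
    rw [Finset.sum_sub_distrib]; linarith
  have hBC' : ∑ γ ∈ S, ((Φ γ).ord (algebraMap F F' (P.uniformizer : F)) * ((Φ γ).degree : ℤ) -
      ((Φ γ).degree : ℤ)) = 0 := by
    rw [Finset.sum_sub_distrib]; linarith
  rw [Finset.sum_eq_zero_iff_of_nonneg (fun γ hγ => sub_nonneg.2 (hCD γ hγ))] at hCD'
  rw [Finset.sum_eq_zero_iff_of_nonneg (fun γ hγ => sub_nonneg.2 (hBC γ hγ))] at hBC'
  have hdegeq : ∀ γ ∈ S, (Φ γ).degree = γ.natDegree * P.degree := fun γ hγ => by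
    have := hCD' γ hγ; exact_mod_cast (sub_eq_zero.1 this)
  have heeq : ∀ γ ∈ S, (Φ γ).ord (algebraMap F F' (P.uniformizer : F)) = 1 := fun γ hγ => by
    have h := sub_eq_zero.1 (hBC' γ hγ)
    have hd : ((Φ γ).degree : ℤ) ≠ 0 := by
      have := PlaceOver.degree_pos_holds (Φ γ); positivity
    have : ((Φ γ).ord (algebraMap F F' (P.uniformizer : F)) - 1) * ((Φ γ).degree : ℤ) = 0 := by
      linarith
    linarith [(mul_eq_zero.1 this).resolve_right hd]
  -- every place above `P` is some `Φ γ`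
  have hAB' : ∑ Q ∈ T \ S.image Φ, Q.ord (algebraMap F F' (P.uniformizer : F)) * (Q.degree : ℤ) = 0 := by
    have := Finset.sum_sdiff himage (f := fun Q : PlaceOver K F' =>
      Q.ord (algebraMap F F' (P.uniformizer : F)) * (Q.degree : ℤ))
    rw [Finset.sum_image hinj] at this
    linarith
  rw [Finset.sum_eq_zero_iff_of_nonneg (fun Q hQ => hnonnegT Q (Finset.mem_sdiff.1 hQ).1)] at hAB'
  have hall : ∀ P' : PlaceOver K F', P'.restrict (K := K) (F := F) = P → ∃ γ ∈ S, Φ γ = P' := by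
    intro P' hP'
    by_contra hno
    push Not at hno
    have hmem : P' ∈ T \ S.image Φ := by
      refine Finset.mem_sdiff.2 ⟨(hTmem P').2 hP', fun h => ?_⟩
      obtain ⟨γ, hγ, hγP'⟩ := Finset.mem_image.1 h
      exact hno γ hγ hγP'
    have h0 := hAB' P' hmem
    have h1 := P'.one_le_ord_algebraMap_uniformizer (K := K) (F := F)
    rw [hP'] at h1
    have h2 : (0 : ℤ) < P'.degree := by exact_mod_cast PlaceOver.degree_pos_holds P'
    nlinarith
  exact ⟨Φ, hinj, hall, fun γ hγ => ⟨hres γ hγ, hroot γ hγ, heeq γ hγ, hdegeq γ hγ⟩⟩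


/-- **All places above `P` are unramified when the reduced minimal polynomial is separable**
(Stichtenoth Cor. 3.3.8 (c); the `[Finite K]`-free form of the tree's
`ord_algebraMap_uniformizer_eq_one_of_separable`, from the bijection of Thm. 3.3.7).
[cite: Stichtenoth2009, Cor. 3.3.8(c)] -/
private theorem ord_algebraMap_uniformizer_eq_one_of_separable' (P : PlaceOver K F) {y : F'}
    {φ : (P.toValuationSubring)[X]} (hφm : φ.Monic)
    (hφ : minpoly F y = φ.map (algebraMap P.toValuationSubring F))
    (hdeg : Module.finrank F F' = φ.natDegree)
    (hsep : (φ.map (IsLocalRing.residue P.toValuationSubring)).Separable)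
    (P' : PlaceOver K F') (hP' : P'.restrict (K := K) (F := F) = P) :
    P'.ord (algebraMap F F' (P.uniformizer : F)) = 1 := by
  set φbar : (P.residueField)[X] := φ.map (IsLocalRing.residue P.toValuationSubring) with hφbar
  have hφbar_m : φbar.Monic := hφm.map _
  have hφbar0 : φbar ≠ 0 := hφbar_m.ne_zero
  set S : Finset (P.residueField)[X] :=
    (UniqueFactorizationMonoid.normalizedFactors φbar).toFinset with hS
  have hSirr : ∀ γ ∈ S, Irreducible γ := fun γ hγ =>
    UniqueFactorizationMonoid.irreducible_of_normalized_factor γ (Multiset.mem_toFinset.1 hγ)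
  have hSmon : ∀ γ ∈ S, γ.Monic := fun γ hγ => by
    have hmem := Multiset.mem_toFinset.1 hγ
    have hγ0 : γ ≠ 0 :=
      (UniqueFactorizationMonoid.irreducible_of_normalized_factor γ hmem).ne_zero
    have h := Polynomial.monic_normalize hγ0
    rwa [UniqueFactorizationMonoid.normalize_normalized_factor γ hmem] at h
  have hSprod : ∏ γ ∈ S, γ = φbar := by
    have hnodup : (UniqueFactorizationMonoid.normalizedFactors φbar).Nodup :=
      (UniqueFactorizationMonoid.squarefree_iff_nodup_normalizedFactors hφbar0).1 hsep.squarefree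
    rw [Finset.prod_eq_multiset_prod, hS, Multiset.toFinset_val, hnodup.dedup, Multiset.map_id']
    have hpm : (UniqueFactorizationMonoid.normalizedFactors φbar).prod.Monic := by
      have h := monic_multiset_prod_of_monic (UniqueFactorizationMonoid.normalizedFactors φbar)
        (fun γ => γ) (fun γ hγ => hSmon γ (by rw [hS]; exact Multiset.mem_toFinset.2 hγ))
      rwa [Multiset.map_id'] at h
    exact eq_of_monic_of_associated hpm hφbar_m
      (UniqueFactorizationMonoid.prod_normalizedFactors hφbar0)
  obtain ⟨Φ, -, hall, hΦ⟩ :=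
    P.exists_placesOver_of_prod_eq_of_isAlgFunctionField hφm hφ hdeg S hSirr hSmon hSprod
  obtain ⟨γ, hγS, rfl⟩ := hall P' hP'
  exact (hΦ γ hγS).2.2.1

/-- **`F' = F(y)`, `y^p = u` with `u ∈ 𝒪_Pˣ` and `p ≠ 0` in `K`: every place of `F'` above `P`
is unramified** (`e(P'|P) = 1`). The minimal polynomial of `y` over `F` lies in `𝒪_P[T]`, divides
`T^p - u`, and its reduction divides the separable `T^p - ū`; conclude by Kummer's theorem
(Stichtenoth Cor. 3.3.8 (c)). This is Stichtenoth Prop. 3.7.3 (b) in the case `v_P(u) = 0`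
(`r_P = n`, `e = n / r_P = 1`), valid without roots of unity in `K` (Remark 3.7.5) and without the
irreducibility hypothesis (3.93). [cite: Stichtenoth2009, Prop. 3.7.3(b) and Remark 3.7.5] -/
theorem ord_algebraMap_uniformizer_eq_one_of_pow_eq_of_ord_eq_zero (P : PlaceOver K F)
    {p : ℕ} (hp : 0 < p) (hpK : (p : K) ≠ 0) {u : F} (hu0 : u ≠ 0) (hu : P.ord u = 0)
    {y : F'} (hy : y ^ p = algebraMap F F' u) (hgen : F⟮y⟯ = ⊤)
    (P' : PlaceOver K F') (hP' : P'.restrict (K := K) (F := F) = P) :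
    P'.ord (algebraMap F F' (P.uniformizer : F)) = 1 := by
  -- `u ∈ 𝒪_Pˣ`
  have huO : u ∈ P.toValuationSubring := (P.mem_toValuationSubring_iff_ord_nonneg hu0).2 hu.ge
  set uO : P.toValuationSubring := ⟨u, huO⟩ with huO'
  have hubar : IsLocalRing.residue P.toValuationSubring uO ≠ 0 := by
    rw [ne_eq, P.residue_eq_zero_iff_ord_pos huO hu0, hu]
    exact lt_irrefl 0
  -- `y` is integral over `𝒪_P`, a root of `T^p - u`
  set ψ : (P.toValuationSubring)[X] := X ^ p - C uO with hψ
  have hψm : ψ.Monic := monic_X_pow_sub_C uO hp.ne'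
  have hψy : aeval y ψ = 0 := by
    rw [hψ, map_sub, map_pow, aeval_X, aeval_C, hy, sub_eq_zero]; rfl
  have hyint : IsIntegral P.toValuationSubring y := ⟨ψ, hψm, by rw [← aeval_def]; exact hψy⟩
  set φ := minpoly P.toValuationSubring y with hφ
  have hφm : φ.Monic := minpoly.monic hyint
  have hφF : minpoly F y = φ.map (algebraMap P.toValuationSubring F) :=
    minpoly.isIntegrallyClosed_eq_field_fractions' F hyint
  have hφdvd : φ ∣ ψ := minpoly.isIntegrallyClosed_dvd hyint hψy
  -- `[F' : F] = deg φ`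
  have hdeg : Module.finrank F F' = φ.natDegree := by
    rw [← (hφm.natDegree_map (algebraMap P.toValuationSubring F)), ← hφF,
      ← IntermediateField.adjoin.finrank (IsIntegral.of_finite F y), hgen]
    exact IntermediateField.finrank_top'.symm
  -- the reduction of `φ` divides the separable `T^p - ū`
  have hsep : (φ.map (IsLocalRing.residue P.toValuationSubring)).Separable := by
    have hψbar : (ψ.map (IsLocalRing.residue P.toValuationSubring)) =
        X ^ p - C (IsLocalRing.residue P.toValuationSubring uO) := by
      rw [hψ, Polynomial.map_sub, Polynomial.map_pow, map_X, map_C]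
    have hpres : (p : P.residueField) ≠ 0 := by
      rw [show (p : P.residueField) = algebraMap K P.residueField p by simp]
      exact (_root_.map_ne_zero _).2 hpK
    have hsepψ : (ψ.map (IsLocalRing.residue P.toValuationSubring)).Separable := by
      rw [hψbar]; exact separable_X_pow_sub_C _ hpres hubar
    exact hsepψ.of_dvd (Polynomial.map_dvd _ hφdvd)
  exact P.ord_algebraMap_uniformizer_eq_one_of_separable' hφm hφF hdeg hsep P' hP'


/-- **`F' = F(g)`, `g^p = f` with `v_P(f) = p k ≥ 0`: every place of `F'` above `P` is
unramified** (`e(P'|P) = 1`; Stichtenoth Prop. 3.7.3 (b), case `r_P = gcd(n, v_P(u)) = n`):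
rescale to `y = g / π_P^k`, a root of `T^p - f / π_P^{pk}` with `f / π_P^{pk} ∈ 𝒪_Pˣ`, which still
generates `F'/F`, and apply `ord_algebraMap_uniformizer_eq_one_of_pow_eq_of_ord_eq_zero`.
[cite: Stichtenoth2009, Prop. 3.7.3(b) and Remark 3.7.5] -/
theorem ord_algebraMap_uniformizer_eq_one_of_pow_eq (P : PlaceOver K F)
    {p : ℕ} (hp : 0 < p) (hpK : (p : K) ≠ 0) {f : F} (hf0 : f ≠ 0) {k : ℕ}
    (hk : P.ord f = p * k) {g : F'} (hg : g ^ p = algebraMap F F' f) (hgen : F⟮g⟯ = ⊤)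
    (P' : PlaceOver K F') (hP' : P'.restrict (K := K) (F := F) = P) :
    P'.ord (algebraMap F F' (P.uniformizer : F)) = 1 := by
  set π : F := (P.uniformizer : F) with hπ
  have hπ0 : π ≠ 0 := P.coe_uniformizer_ne_zero
  have hπ1 : P.ord π = 1 := P.ord_uniformizer_eq_one
  -- `u = f / π^{pk}` is a unit at `P`, and `y = g / π^k` satisfies `y^p = u`
  set u : F := f / π ^ (p * k) with hu
  have hu0 : u ≠ 0 := div_ne_zero hf0 (pow_ne_zero _ hπ0)
  have hordu : P.ord u = 0 := by
    rw [hu, P.ord_div hf0 (pow_ne_zero _ hπ0), P.ord_pow hπ0, hk, hπ1]; push_cast; ring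
  set y : F' := g / algebraMap F F' π ^ k with hy
  have hyp : y ^ p = algebraMap F F' u := by
    rw [hy, div_pow, hg, hu, map_div₀, map_pow, ← pow_mul, mul_comm k p]
  have hgy : g = y * algebraMap F F' π ^ k := by
    rw [hy, div_mul_cancel₀]
    exact pow_ne_zero _ ((_root_.map_ne_zero _).2 hπ0)
  have hgen' : F⟮y⟯ = ⊤ := by
    refine top_unique ?_
    rw [← hgen, IntermediateField.adjoin_simple_le_iff, hgy]
    exact mul_mem (IntermediateField.mem_adjoin_simple_self F y)
      (pow_mem (IntermediateField.algebraMap_mem F⟮y⟯ π) k)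
  exact P.ord_algebraMap_uniformizer_eq_one_of_pow_eq_of_ord_eq_zero hp hpK hu0 hordu hyp hgen' P' hP'


/-- **The radical base change of a Belyi-type function is unramified over the `g`-line off
`g^p = 1`.** Let `f ∈ F` be transcendental over `K` with `v_P(f) = p` at every zero of `f`, and
suppose `F/K(f)` is unramified over every closed point `π₀ ∉ {X, X - 1}` of the `f`-line
(`v_P(π₀(f)) > 0 ⇒ v_P(π₀(f)) = 1`, `π₀` monic irreducible). Let `F' = F(g)` with `g^p = f`
(`p ≠ 0` in `K`). Then for every monic irreducible `π ∈ K[X]` with `π ∤ X^p - 1` and every place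
`Q` of `F'`: `v_Q(π(g)) > 0 ⇒ v_Q(π(g)) = 1`. Proof: `g ∈ 𝒪_Q` and `π = minpoly_K(ḡ)`; with
`P = Q ∩ F`, either `v_Q(g) > 0`, then `v_P(f) = p`, `e(Q|P) = 1`
(`ord_algebraMap_uniformizer_eq_one_of_pow_eq`, `k = 1`), `v_Q(g) = 1` and `π = X`; or
`v_Q(g) = 0`, then `v_P(f) = 0`, `e(Q|P) = 1` (`k = 0`), and for `ν = minpoly_K(f̄)` (`ν ≠ X, X - 1`
as `f̄ ≠ 0` and `ḡ^p ≠ 1`) the hypothesis gives `v_Q(ν(f)) = v_P(ν(f)) = 1`, while `π ρ = ν(X^p)`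
and `ν(f) = ν(X^p)(g)`, so `v_Q(π(g)) ≤ 1`. This is the function-field half ("the covering obtained
by base change along `z ↦ z^p` is unramified above `0`") of the specialisation argument for
Darmon–Granville's Prop. 3.2. [cite: DarmonGranville1995, Prop. 3.2 (proof sketch)]
[cite: Stichtenoth2009, Prop. 3.7.3(b)] -/
theorem ord_aeval_eq_one_of_pow_eq {p : ℕ} (hp : 0 < p) (hpK : (p : K) ≠ 0)
    {f : F} (hf : Transcendental K f)
    (h₀ : ∀ P : PlaceOver K F, 0 < P.ord f → P.ord f = p)
    (hunr : ∀ π₀ : K[X], Irreducible π₀ → π₀.Monic → π₀ ≠ X → π₀ ≠ X - 1 →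
      ∀ P : PlaceOver K F, 0 < P.ord (aeval f π₀) → P.ord (aeval f π₀) = 1)
    {g : F'} (hg : g ^ p = algebraMap F F' f) (hgen : F⟮g⟯ = ⊤)
    {π : K[X]} (hπi : Irreducible π) (hπm : π.Monic) (hπp : ¬ π ∣ X ^ p - 1)
    (Q : PlaceOver K F') (hQ : 0 < Q.ord (aeval g π)) : Q.ord (aeval g π) = 1 := by
  have hf0 : f ≠ 0 := fun h => hf (h ▸ isAlgebraic_zero)
  have haf : ∀ q : K[X], q ≠ 0 → aeval f q ≠ 0 := fun q hq h =>
    hf (⟨q, hq, h⟩ : IsAlgebraic K f)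
  have hg0 : g ≠ 0 := by
    rintro rfl; rw [zero_pow hp.ne'] at hg
    exact hf0 ((_root_.map_eq_zero _).1 hg.symm)
  have hπdeg : 0 < π.natDegree := Irreducible.natDegree_pos hπi
  -- `g ∈ 𝒪_Q`, `P = Q ∩ F`, `e = e(Q|P)`
  have hgO : g ∈ Q.toValuationSubring := Q.mem_of_ord_aeval_pos hπdeg hQ
  have hordg : 0 ≤ Q.ord g := Q.ord_nonneg_of_mem hgO
  set P := Q.restrict (K := K) (F := F) with hP
  have hBP : ∀ x : F, algebraMap F F' x ∈ Q.toValuationSubring ↔ x ∈ P.toValuationSubring :=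
    fun x => (Q.mem_restrict_iff (K := K) (F := F) x).symm
  set e := Q.ord (algebraMap F F' (P.uniformizer : F)) with he
  have he1 : 1 ≤ e := Q.one_le_ord_algebraMap_uniformizer (K := K) (F := F)
  have hordF : ∀ y : F, Q.ord (algebraMap F F' y) = e * P.ord y :=
    fun y => Q.ord_algebraMap_eq_mul (K := K) (F := F) y
  -- `e · ord_P f = p · ord_Q g`
  have hfg : e * P.ord f = p * Q.ord g := by rw [← hordF, ← hg, Q.ord_pow hg0]
  have hordPf : 0 ≤ P.ord f := by
    have h1 : 0 ≤ e * P.ord f := by rw [hfg]; positivity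
    by_contra hneg
    have : e * P.ord f < 0 := mul_neg_of_pos_of_neg (by omega) (by omega)
    omega
  -- `π = minpoly_K ḡ`
  set gbar := IsLocalRing.residue Q.toValuationSubring ⟨g, hgO⟩ with hgbar
  have hπg : aeval gbar π = 0 := (Q.ord_aeval_pos_iff hgO (fun h => by
    rw [h, PlaceOver.ord_zero] at hQ; exact lt_irrefl _ hQ)).1 hQ
  have hπmin : π = minpoly K gbar := minpoly.eq_of_irreducible_of_monic hπi hπg hπm
  rcases hordg.lt_or_eq with hpos | hzero
  · -- Case `ord_Q g > 0`: `P` is a zero of `f`, `ord_P f = p`, `e = 1`, `ord_Q g = 1`, `π = X`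
    have hPf : 0 < P.ord f := by
      rcases hordPf.lt_or_eq with h | h
      · exact h
      · exfalso; rw [← h, mul_zero] at hfg
        have : (0 : ℤ) < p * Q.ord g := mul_pos (by exact_mod_cast hp) hpos
        omega
    have hPfp : P.ord f = p := h₀ P hPf
    have he' : e = 1 := P.ord_algebraMap_uniformizer_eq_one_of_pow_eq hp hpK hf0 (k := 1)
      (by rw [hPfp]; push_cast; ring) hg hgen Q rfl
    have hg1 : Q.ord g = 1 := by
      rw [he', one_mul, hPfp] at hfg
      have : (p : ℤ) * (Q.ord g - 1) = 0 := by rw [mul_sub, ← hfg, mul_one, sub_self]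
      rcases mul_eq_zero.1 this with h | h
      · exfalso; exact hp.ne' (by exact_mod_cast h)
      · omega
    have hgbar0 : gbar = 0 := (Q.residue_eq_zero_iff_ord_pos hgO hg0).2 hpos
    have hπX : π = X := by rw [hπmin, hgbar0, minpoly.zero]
    rw [hπX, aeval_X, hg1]
  · -- Case `ord_Q g = 0`: `ord_P f = 0`, `e = 1`, and `hunr` at `ν = minpoly_K f̄`
    have hPf : P.ord f = 0 := by
      rw [← hzero, mul_zero] at hfg
      rcases mul_eq_zero.1 hfg with h | h
      · omega
      · exact h
    have he' : e = 1 := P.ord_algebraMap_uniformizer_eq_one_of_pow_eq hp hpK hf0 (k := 0)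
      (by rw [hPf]; push_cast; ring) hg hgen Q rfl
    have hfO : f ∈ P.toValuationSubring := (P.mem_toValuationSubring_iff_ord_nonneg hf0).2 hPf.ge
    set fbar := IsLocalRing.residue P.toValuationSubring ⟨f, hfO⟩ with hfbar
    -- the `K`-embedding `F_P → F'_Q` maps `f̄` to `ḡ^p`
    set ι : P.residueField →ₐ[K] Q.residueField :=
      { IsLocalRing.ResidueField.map (resHom P Q hBP) with
        commutes' := fun c => by
          have := congrArg (fun φ => φ c) (residueField_map_comp_algebraMap (P := P) (P' := Q) hBP)
          exact this } with hι
    have hιf : ι fbar = gbar ^ p := by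
      change IsLocalRing.ResidueField.map (resHom P Q hBP) (IsLocalRing.residue _ ⟨f, hfO⟩) = _
      rw [← residue_algebraMap_eq P Q hBP ⟨f, hfO⟩, hgbar, ← map_pow]
      congr 1
      apply Subtype.ext
      change algebraMap F F' f = g ^ p
      rw [hg]
    haveI : FiniteDimensional K P.residueField := finiteDimensional_residueField_holds P
    set ν := minpoly K fbar with hν
    have hνm : ν.Monic := minpoly.monic (IsIntegral.of_finite K fbar)
    have hνi : Irreducible ν := minpoly.irreducible (IsIntegral.of_finite K fbar)
    have hfbar0 : fbar ≠ 0 := fun h => by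
      rw [hfbar, P.residue_eq_zero_iff_ord_pos hfO hf0, hPf] at h; exact lt_irrefl _ h
    have hνX : ν ≠ X := fun h => by
      have := minpoly.aeval K fbar
      rw [← hν, h, aeval_X] at this
      exact hfbar0 this
    have hνX1 : ν ≠ X - 1 := fun h => by
      have h1 := minpoly.aeval K fbar
      rw [← hν, h, map_sub, aeval_X, aeval_one, sub_eq_zero] at h1
      -- then `ḡ^p = 1`, so `π = minpoly ḡ ∣ X^p - 1`
      apply hπp
      rw [hπmin]
      apply minpoly.dvd
      rw [map_sub, map_pow, aeval_X, aeval_one, ← hιf, h1, map_one, sub_self]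
    -- `ord_P ν(f) = 1` by `hunr`, hence `ord_Q ν(f) = e = 1`
    have hνf0 : aeval f ν ≠ 0 := haf ν hνm.ne_zero
    have hνf : 0 < P.ord (aeval f ν) := (P.ord_aeval_pos_iff hfO hνf0).2 (minpoly.aeval K fbar)
    have hνf1 : Q.ord (algebraMap F F' (aeval f ν)) = 1 := by
      rw [hordF, hunr ν hνi hνm hνX hνX1 P hνf, he', mul_one]
    -- `ν(f) = ν(g^p) = (ν ∘ X^p)(g)` and `π ∣ ν ∘ X^p`
    have hcomp : algebraMap F F' (aeval f ν) = aeval g (ν.comp (X ^ p)) := by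
      rw [← aeval_algebraMap_apply, ← hg, aeval_comp, map_pow, aeval_X]
    have hdvd : π ∣ ν.comp (X ^ p) := by
      rw [hπmin]
      apply minpoly.dvd
      rw [aeval_comp, map_pow, aeval_X, ← hιf, aeval_algHom_apply, minpoly.aeval, map_zero]
    obtain ⟨ρ, hρ⟩ := hdvd
    have hρ0 : aeval g ρ ≠ 0 := by
      intro h
      have : aeval g (ν.comp (X ^ p)) = 0 := by rw [hρ, map_mul, h, mul_zero]
      rw [← hcomp, _root_.map_eq_zero] at this
      exact hνf0 this
    have hπ0 : aeval g π ≠ 0 := fun h => by rw [h, PlaceOver.ord_zero] at hQ; exact lt_irrefl _ hQ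
    have hsum : Q.ord (aeval g π) + Q.ord (aeval g ρ) = 1 := by
      rw [← Q.ord_mul_eq hπ0 hρ0, ← map_mul, ← hρ, ← hcomp, hνf1]
    have hρord : 0 ≤ Q.ord (aeval g ρ) := Q.ord_nonneg_of_mem (Q.aeval_mem hgO ρ)
    omega

end KummerCount

end PlaceOver

end Literature.NumberTheory.DiophantineGeometry.AlgFunctionField
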